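import Literature.NumberTheory.LFunctions.BilinearKloostermanSumsGeneralModulus
import HarnessLib

/-!
# Bilinear forms with Kloosterman sums to a COMPOSITE modulus beyond the Fourier bound
# (Pascadi, *Non-abelian amplification and bilinear forms with Kloosterman sums*, GAFA 2026 =
# arXiv:2511.08445, §7.1 Theorem 7.1)

Topic `Literature/NumberTheory/LFunctions` (namespace `Literature.NumberTheory.LFunctions`,
sub-namespace `Pascadi2025` for the paper's objects). STATEMENT LAYER (D-0014: a sorry-free named
`Prop` fact; nothing deep asserted), the composite-modulus successor of the Type II inputs typed in
`BilinearKloostermanSumsPrimeModulus.lean` (FKM 2014 / KMS 2017, prime modulus) and of the Type I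
inputs of `BilinearKloostermanSumsGeneralModulus.lean` (KSWX 2023, whose `interval` and `l2Norm` are
REUSED here). Typed for the route `PrimeLevelFamEdge`, crux K_A `MomentsBeyondDiagonal`
(stmt-Parity-20007), line «petersson_layers»: the PRINT BAND `(ρ_P, ρ_W]` of the registered stub
`stub_farP : SubFar rhoP` (Petersson moduli `c = q·r`, `q` prime, `q̂^{ρ_P} < r ≤ q̂^{ρ_W}`) is, by
the line card and deck 21c, «Pascadi Thm 7.1 with `(d, d′, e) = (r, 1, q)`, `f = r`» — the theorem
`pascadi2025_theorem71_primeCofactor` below, DERIVED here from the general statement (taken as hypothesis).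

## What the source prints (held text `paper:arxiv-2511.08445`, p0025 L11–L27, read 2026-08-31; notation
## p0009 L11–L13: «`f(x) ≪ x^{o(1)} g(x)` is equivalent to the statement that `f(x) ≪_ε x^ε g(x)` for all
## `ε > 0`»; «`‖α‖ := (Σ_n |α_n|²)^{1/2}` for the `ℓ²` norm of a sequence `(α_n)_{n ∈ ℐ}` for some
## `ℐ ⊂ ℤ`»; p0003 L13–L17: `S(m,n;c) := Σ_{x ∈ (ℤ/cℤ)^×} e((mx + n x̄)/c)`, «(integer) intervals
## `ℐ, 𝒥 ⊂ ℤ` with `|ℐ| = M ≤ c`, `|𝒥| = N ≤ c`»)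

* **Theorem 7.1** (§7.1 «Composite moduli», «a generalization of Theorem 1.2, which allows for larger
  values of `M, N`»): "Let `c = dd′e` for some `d, d′, e ∈ ℤ_+` with `d′ ∣ d` and `(d, e) = 1`, and
  `f ≤ √(cd)` be the largest integer with `f² ∣ cd`. Let `ℐ, 𝒥 ⊂ ℤ` be intervals of lengths
  `|ℐ| = M`, `|𝒥| = N`, with `1 ≤ N ≤ M ≤ c`. Then for any complex sequences `(α_m)_{m ∈ ℐ}`,
  `(β_n)_{n ∈ 𝒥}` and `a ∈ (ℤ/cℤ)^×`, one has
  `ΣΣ_{m ∈ ℐ, n ∈ 𝒥, (m,n,c) = 1} α_m β_n S(am, n; c)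
     ≪ ‖α‖ ‖β‖ c^{1+o(1)} (dM³N/c³ + fM²/c² + f/d²)^{1/6}
     = ‖α‖ ‖β‖ c^{o(1)} √(MNc) (d/N² + fc/(MN³) + fc³/(d²M³N³))^{1/6}`."
  (Footnote: «The assumption that `N ≤ M` is only included to shorten the statement …; one can of
  course swap `m` and `n` in the bilinear sum, up to swapping `M` and `N` in the upper bound.»)
* Example 7.2 (p0025 L29–L31, not typed): for `M ≍ N` the bound beats Weil from `N = c^{2/5+o(1)}`
  (e.g. `c = pq`, `p ≍ q^{3/2}`) and beats the Fourier bound `c^{1+o(1)}‖α‖‖β‖` up to `N = c^{3/4−o(1)}`.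

## Lean rendering / design choices

* `S(m, n; c)` = the tree's `Literature.NumberTheory.LFunctions.kloostermanSum c m n`
  (`KloostermanPrimePower.lean`), integers cast into `ZMod c`; `S(am, n; c)` = `kloostermanSum c (a * m) n`
  with `a : ZMod c` a unit.  Not re-defined.
* `ℐ = {M₀+1,…,M₀+M}`, `𝒥 = {N₀+1,…,N₀+N}` = `KSWX2023.interval M₀ M`, `KSWX2023.interval N₀ N`
  (`Finset.Ioc` in `ℤ`); `‖α‖ = KSWX2023.l2Norm M₀ M α`, `‖β‖ = KSWX2023.l2Norm N₀ N β` — REUSED.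
* `(m, n, c) = 1` (for integers `m, n`) = `Nat.Coprime (Int.gcd m n) c`; the restricted double sum is
  `Pascadi2025.coprimeTypeIISum` (an `if … then … else 0` summand).
* `≪ ‖α‖‖β‖ c^{1+o(1)} (…)^{1/6}` is rendered by the paper's own convention (p0009): for every
  `ε > 0` there is `C = C(ε)` such that the bound holds with `C c^{1+ε}` for ALL admissible data
  (`c ≥ 1`; implied constant otherwise absolute, as printed — no other dependence is indicated).
  Only the first printed form of the right-hand side is typed (the second is the same number).
* "`f ≤ √(cd)` the largest integer with `f² ∣ cd`" = `Pascadi2025.IsMaxSqDiv f (c * d)`: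
  `f² ∣ cd ∧ ∀ g, g² ∣ cd → g ≤ f` (then automatically `1 ≤ f ≤ √(cd)`).
* The instance used by the route (`c = q r`, `q` prime, `q ∤ r`: `(d, d′, e) = (r, 1, q)`, `f = r`)
  is the THEOREM `pascadi2025_theorem71_primeCofactor (h : pascadi2025_theorem71) : …` (no second named
  fact): `r² ∣ qr·r` is maximal since `g² ∣ q r²`, `q` prime, `q ∤ r` force `g ∣ r`.
* NOT typed (index only): Theorems 1.1/1.2 (the special cases `c = p²`, `c = pq` advertised in the
  introduction), Theorem 7.3 ff. (general moduli via the `d`-divisor structure), §8 (large sieve for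
  exceptional Maass forms), Example 7.2 and the Remark on the unbalanced range `M > N` (p0025 L33 —
  a remark, not a theorem: no additional saving for `M > N` is asserted in print).

Status: theorem-in-print (GAFA 2026; arXiv v1 numbering). Typed ≠ proved. Nothing here is a statement
about `MomentsBeyondDiagonal`, about Landau–Siegel zeros, or about any moment of `L`-functions.

## References

* [Pascadi2025] A. Pascadi, *Non-abelian amplification and bilinear forms with Kloosterman sums*,
  Geom. Funct. Anal. (2026), doi:10.1007/s00039-026-00746-0 = arXiv:2511.08445: §1.1 (1.2)–(1.3)
  (p0003), §3.1 notation (p0009), §7.1 Theorem 7.1, Example 7.2 (p0025).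
* Tree: `kloostermanSum` (KloostermanPrimePower.lean); `KSWX2023.interval`, `KSWX2023.l2Norm`
  (BilinearKloostermanSumsGeneralModulus.lean); the Fourier-theoretic trivial bound (1.3) is PROVED
  Summits-side as `Summit.Parity.GeneralizedHardyLittlewood.Theorems.MomentsBeyondDiagonal.Layers.norm_bilinear_kloostermanSum_le`.
-/

noncomputable section

open Finset

namespace Literature.NumberTheory.LFunctions

namespace Pascadi2025

/-- The coprimality-restricted Type II bilinear form of Theorem 7.1:
`ΣΣ_{m ∈ ℐ, n ∈ 𝒥, (m,n,c)=1} α_m β_n S(am, n; c)`, `ℐ = {M₀+1,…,M₀+M}`, `𝒥 = {N₀+1,…,N₀+N} ⊂ ℤ`,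
`a ∈ ℤ/cℤ`, `S = kloostermanSum`. [cite: Pascadi2025, Thm. 7.1 (left-hand side); §1.1 (1.3)] -/
def coprimeTypeIISum (c : ℕ) [NeZero c] (a : ZMod c) (M₀ : ℤ) (M : ℕ) (N₀ : ℤ) (N : ℕ)
    (α β : ℤ → ℂ) : ℂ :=
  ∑ m ∈ KSWX2023.interval M₀ M, ∑ n ∈ KSWX2023.interval N₀ N,
    if Nat.Coprime (Int.gcd m n) c then
      α m * β n * kloostermanSum c (a * ((m : ℤ) : ZMod c)) ((n : ℤ) : ZMod c) else 0

/-- "`f` is the largest integer with `f² ∣ k`" (for `k = cd` in Theorem 7.1). [cite: Pascadi2025, Thm. 7.1 (definition of f)] -/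
def IsMaxSqDiv (f k : ℕ) : Prop := f ^ 2 ∣ k ∧ ∀ g : ℕ, g ^ 2 ∣ k → g ≤ f

/-- The printed bracket of Theorem 7.1 (first form): `Φ(M, N; c, d, f) = dM³N/c³ + fM²/c² + f/d²`.
[cite: Pascadi2025, Thm. 7.1 (right-hand side)] -/
def bracket71 (M N c d f : ℝ) : ℝ := d * M ^ 3 * N / c ^ 3 + f * M ^ 2 / c ^ 2 + f / d ^ 2

end Pascadi2025

open Pascadi2025

/-! ### The named fact (statement layer; theorem in print, not proved here) -/

/-- **Pascadi, GAFA 2026 (arXiv:2511.08445), Theorem 7.1** (bilinear Kloosterman forms, composite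
modulus), as printed: "Let `c = dd′e` for some `d, d′, e ∈ ℤ_+` with `d′ ∣ d` and `(d, e) = 1`, and
`f ≤ √(cd)` be the largest integer with `f² ∣ cd`. Let `ℐ, 𝒥 ⊂ ℤ` be intervals of lengths `|ℐ| = M`,
`|𝒥| = N`, with `1 ≤ N ≤ M ≤ c`. Then for any complex sequences `(α_m)_{m∈ℐ}`, `(β_n)_{n∈𝒥}` and
`a ∈ (ℤ/cℤ)^×`, one has `ΣΣ_{m∈ℐ, n∈𝒥, (m,n,c)=1} α_m β_n S(am,n;c) ≪ ‖α‖‖β‖ c^{1+o(1)}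
(dM³N/c³ + fM²/c² + f/d²)^{1/6}`."  Rendered (paper's convention §3.1: `≪ c^{o(1)}·` = `≪_ε c^ε·` for
every `ε > 0`): for every `ε > 0` there is `C` such that for all such `c, d, d′, e, f`, all
`M₀, N₀ ∈ ℤ`, `1 ≤ N ≤ M ≤ c`, all units `a` and all `α, β`,
`‖Σ‖ ≤ C ‖α‖ ‖β‖ c^{1+ε} (dM³N/c³ + fM²/c² + f/d²)^{1/6}`.
-- TODO(general form): the footnote's symmetric version (`M ≤ N`, swap `M`, `N` in the bracket) is the
-- same statement applied to the transposed sum; Theorem 7.3 ff. (arbitrary `c` through its divisor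
-- structure) and the `q`-aspect large sieve of §8 are not typed.
[cite: Pascadi2025, Thm. 7.1] -/
def pascadi2025_theorem71 : Prop :=
  ∀ ε : ℝ, 0 < ε → ∃ C : ℝ, ∀ (c d d' e f : ℕ) [NeZero c], c = d * d' * e → d' ∣ d → Nat.Coprime d e →
    IsMaxSqDiv f (c * d) →
    ∀ (M₀ N₀ : ℤ) (M N : ℕ), 1 ≤ N → N ≤ M → M ≤ c →
    ∀ (a : ZMod c), IsUnit a → ∀ (α β : ℤ → ℂ),
      ‖coprimeTypeIISum c a M₀ M N₀ N α β‖ ≤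
        C * KSWX2023.l2Norm M₀ M α * KSWX2023.l2Norm N₀ N β * (c : ℝ) ^ (1 + ε) *
          (bracket71 M N c d f) ^ (1 / 6 : ℝ)

namespace Pascadi2025

/-! ### Bookkeeping (proved): `f = r` is the maximal square divisor datum of `cd = q r²` -/

/-- For `q` prime with `q ∤ r`: `g² ∣ q·r²` forces `g ∣ r`. [folklore] -/
private theorem dvd_of_sq_dvd_prime_mul_sq {q r g : ℕ} (hq : q.Prime) (hqr : ¬ q ∣ r) (hg : g ^ 2 ∣ q * r ^ 2) :
    g ∣ r := by
  have hgq : Nat.Coprime g q := by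
    rw [Nat.coprime_comm, hq.coprime_iff_not_dvd]
    intro hqg
    have h1 : q ^ 2 ∣ q * r ^ 2 := (pow_dvd_pow_of_dvd hqg 2).trans hg
    have h2 : q ∣ r ^ 2 := by
      have h3 : q * q ∣ q * r ^ 2 := by simpa [pow_two] using h1
      exact (Nat.mul_dvd_mul_iff_left hq.pos).mp h3
    exact hqr (hq.dvd_of_dvd_pow h2)
  have h4 : g ^ 2 ∣ r ^ 2 := (Nat.Coprime.pow_left 2 hgq).dvd_of_dvd_mul_left hg
  exact (Nat.pow_dvd_pow_iff two_ne_zero).mp h4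

/-- For `q` prime, `q ∤ r`, `r ≥ 1`: `r` is the largest integer whose square divides `(qr)·r`. [folklore] -/
private theorem isMaxSqDiv_primeCofactor {q r : ℕ} (hq : q.Prime) (hqr : ¬ q ∣ r) (hr : 0 < r) :
    IsMaxSqDiv r (q * r * r) := by
  refine ⟨⟨q, by ring⟩, fun g hg ↦ ?_⟩
  have hg' : g ^ 2 ∣ q * r ^ 2 := by simpa [pow_two, mul_assoc] using hg
  exact Nat.le_of_dvd hr (dvd_of_sq_dvd_prime_mul_sq hq hqr hg')

end Pascadi2025

/-- **The instance `(d, d′, e) = (r, 1, q)`, `f = r` of Theorem 7.1** (Petersson moduli `c = q·r` at prime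
level `q`, `q ∤ r` — the print band of the line «petersson_layers» on stmt-Parity-20007), DERIVED from the
general fact: for every `ε > 0` there is `C` with
`‖ΣΣ_{(m,n,qr)=1} α_m β_n S(am,n;qr)‖ ≤ C ‖α‖‖β‖ (qr)^{1+ε} (r M³N/(qr)³ + r M²/(qr)² + r/r²)^{1/6}`
for all primes `q`, all `r` with `q ∤ r`, `1 ≤ N ≤ M ≤ qr`, units `a` and coefficients `α, β`
(`c = qr = r·1·q`, `1 ∣ r`, `(r, q) = 1`, and `r² ∣ qr·r` is maximal since `g² ∣ q r²`, `q ∤ r` force `g ∣ r`).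
[cite: Pascadi2025, Thm. 7.1 (case c = qr, d = f = r, d′ = 1, e = q prime)] -/
theorem pascadi2025_theorem71_primeCofactor (h : pascadi2025_theorem71) :
    ∀ ε : ℝ, 0 < ε → ∃ C : ℝ, ∀ (q r : ℕ) [NeZero (q * r)], q.Prime → ¬ q ∣ r →
      ∀ (M₀ N₀ : ℤ) (M N : ℕ), 1 ≤ N → N ≤ M → M ≤ q * r →
      ∀ (a : ZMod (q * r)), IsUnit a → ∀ (α β : ℤ → ℂ),
        ‖coprimeTypeIISum (q * r) a M₀ M N₀ N α β‖ ≤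
          C * KSWX2023.l2Norm M₀ M α * KSWX2023.l2Norm N₀ N β * ((q * r : ℕ) : ℝ) ^ (1 + ε) *
            (bracket71 M N ((q * r : ℕ) : ℝ) r r) ^ (1 / 6 : ℝ) := by
  intro ε hε
  obtain ⟨C, hC⟩ := h ε hε
  refine ⟨C, ?_⟩
  intro q r _ hq hqr M₀ N₀ M N hN hNM hMc a ha α β
  have hr : 0 < r := by
    rcases Nat.eq_zero_or_pos r with h0 | h0
    · exact absurd (h0 ▸ dvd_zero q) hqr
    · exact h0
  have hcop : Nat.Coprime r q := (Nat.coprime_comm.mp ((hq.coprime_iff_not_dvd).mpr hqr))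
  have key := hC (q * r) r 1 q r (by ring) (one_dvd r) hcop
    (by simpa [mul_assoc] using Pascadi2025.isMaxSqDiv_primeCofactor hq hqr hr)
    M₀ N₀ M N hN hNM hMc a ha α β
  have hcast : ((q * r : ℕ) : ℝ) = (q : ℝ) * r := by push_cast; ring
  simpa [hcast] using key

end Literature.NumberTheory.LFunctions

end
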